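import Summits.QuantumFields.YangMills.Theorems.BalabanUVNodesN15TwoSpacingGluingNeumannKnitDefectRecordRows
import HarnessLib

/-!
# THE GLUING STEP AT TWO LATTICE SPACINGS, XL: THE TWO-GRID η-DEFECT OF THE GLUED `U ≡ 1` OPERATOR OF THE COVER ON THE TORUS OF RECORD — FILE 63 ON FILE 73's COVER AT BOTH
# SPACINGS, RATE `(L^K)^{−1∕16}` FOR `L^s ≥ w₀`, CONSTANTS FREE OF THE VOLUME, NO DISPLAYED ROW (dag-n15-c g13, FILE 82; N15 = NE2, s1 «background-layer OPERATOR ingredient»)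

Cell `pub-ymgap`, seat `pub-ymgap-dag-n15-c` (R134 (a); HUMAN RULING D-0062), generation 13.  `bears_on: R4∕N15 · K3⁷ SpineGivenEndpointR13SepCoPH (stmt-QuantumFields-20544)`.
Filed `--supports stmt-QuantumFields-20544 --as helper` — COUNT-NEUTRAL.  Theorems only (0 `def`, 0 `sorry`).  Imports BY NAME FILE 81 (through it FILES 63, 72, 73, 77–80 and
dag-n15-a's PROGRAMMES N ∕ P); nothing in the tree is modified.

WHAT.  On the torus of record `M = MP (paramsOf d L m_T K hL)` (`M_ν = 2L^{m_T}`, the volume exponent `m_T` FREE) take FILE 73's cover: cubes `□_k` of side `L^{s+1}` (lifted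
Neumann propagators `knitGR` = dag-n15-a `liftCubeG`), partition `knitHR`, at the coarse spacing `L^{−K}` and the fine spacing `L^{−(K+r)}` (SAME cubes and partition), King's
pairing `P`, the glued operators `knitGluedR … (L^K)` and `knitGluedR … (L^r·L^K)` (FILE 43 `glueInv` of FILE 45's parametrix ∕ remainder).
★★★ **`hasMaj_idef_knitGluedR`**: for odd `L ≥ 3`, `a > 0` there are `δ, w₀, D > 0` — FREE OF THE VOLUME `m_T`, the cube exponent `s`, the spacings `K, r` — with
`𝔇(G′_glued, G_glued) ≤ D·(L^K)^{−1∕16}·e^{−δ|y−y′|_T}` whenever `s + 1 ≤ m_T`, `K ≥ 1`, `4 ≤ L^K`, `L^s ≥ w₀`: FILE 63 `hasMaj_idef_glued_of_cutRows` fed by P-IIb ∕ P-IIe (cut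
rows, both spacings), FILE 81 (remainder rows `κ₀∕L^s`, both spacings), P-IIc (cut defect), FILE 80 `hasMaj_idef_commOp_deltaOp_comp_knitGR_closed` (remainder defect — the former
displayed row `HY` now dag-n15-a's P-IIi), FILE 67 (partition fit), FILE 72 (overlap `(L+1)^{d+1}`), FILE 45 `glued_smallness_of_M` (the guard `L^s ≥ w₀`), compressed by FILE 78
`glueDefectConst_le`.  With FILE 73 `knitGluedR_spec` (iii) (`G_glued = Δ_a⁻¹` on `Tor(2L^{m_T})` at each spacing for `L^s ≥ w₀`) this is the `U ≡ 1` TWO-GRID COMPOSITION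
CERTIFICATE of [B6] §2's parametrix machine with [B9] Thm 3.14's difference template ON THE TORUS OF RECORD, every hypothesis a tree theorem, the cube letters taken at the CUBE tori
`2L^{s+1}` — so, unlike the doubled-torus edition (FILE 80 §1), not circular through the big torus's own propagator letters: the big torus enters only through `∂Π∂*`'s letter
(part 41) and the Landau two-grid defect (part 47).

HONEST FRAMING ∕ LIMITS.  Block-majorant bookkeeping over LANDED rows at `U ≡ 1` (no new analytic estimate).  Nothing of [B5]∕[B6]∕[B9] asserted: [B9] Thm 3.14 pp.426–427 =
difference TEMPLATE only; [B6] (2.38)–(2.40) NOT asserted; the cubes are Neumann-by-images MODELS of [B6]'s Dirichlet cubes; `U ≡ 1` throughout (no background field).  NE2⁺ NOT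
PRINTED, NOT proved; N15 NOT discharged; counts of record UNMOVED (typed 28∕28 · discharged 5∕27); one finite 𝕋⁴ at fixed ε per index — NOT infinite volume, NOT OS on ℝ⁴, NOT a
mass gap, NOT Clay; R4 closes the conditional finite-𝕋⁴ rung `BalabanLadder.UV` only.  Restate-immune (no Theses import).
-/

noncomputable section

namespace Summit.QuantumFields.YangMills.BalabanUVNodes.N15.Gluing

open Real
open Literature.MathematicalPhysics.QuantumFieldTheory.Balaban1983to89
open Literature.MathematicalPhysics.QuantumFieldTheory.Balaban1983to89.B5Prop11Plancherel (Tor fine)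
open Literature.MathematicalPhysics.QuantumFieldTheory.Balaban1983to89.B11SectG (BlockNorm HasMaj RowSum)
open Literature.MathematicalPhysics.QuantumFieldTheory.Balaban1983to89.T4EtaRateDefect (idef)
open Literature.MathematicalPhysics.QuantumFieldTheory.Balaban1983to89.T4EtaRateCoeffDefect (pull)
open Literature.MathematicalPhysics.QuantumFieldTheory.Balaban1983to89.B6Prop26Gluing (mulOp ind ind_nonneg ind_le_one)
open Literature.MathematicalPhysics.QuantumFieldTheory.Balaban1983to89.B6UnitTorusCarrier (unitTorusGeo triangle254_unitTorusGeo rowSum_unitTorusGeo unitTorusGeo_dist_nonneg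
  unitTorusGeo_dist_self)
open Literature.MathematicalPhysics.QuantumFieldTheory.Balaban1983to89.B5SiteBridgeP12 (MP)
open Literature.MathematicalPhysics.QuantumFieldTheory.King1986.Torus (blockOf tdistT tdistT_nonneg)
open Summit.QuantumFields.YangMills.BalabanUVNodes.N15.VectorPiece (bshiftEquiv kingPrV)
open Summit.QuantumFields.YangMills.BalabanUVNodes.N15.TwoGrid (paramsOf deltaOp chiCube cubeBlocks hasMaj_chiCube_liftCubeG hasMaj_chiCube_liftCubeG_fine
  hasMaj_idef_chiCube_liftCubeG)

variable {d : ℕ}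

section Glued

variable {L : ℕ} [NeZero L]

/-- ★★★ **THE TWO-GRID η-DEFECT OF THE GLUED `U ≡ 1` OPERATOR OF THE COVER ON THE TORUS OF RECORD, FROM CUBE DATA, NO DISPLAYED ROW, CONSTANTS FREE OF THE VOLUME**: for odd
`L ≥ 3`, `a > 0` there are `δ, w₀, D > 0` with `𝔇(G′_glued, G_glued) ≤ D·(L^K)^{−1∕16}·e^{−δ|y−y′|_T}` on `Tor(2L^{m_T})` whenever `s + 1 ≤ m_T`, `K ≥ 1`, `4 ≤ L^K`, `L^s ≥ w₀` —
FILE 63 `hasMaj_idef_glued_of_cutRows` with every hypothesis inhabited (cut rows P-IIb ∕ P-IIe; remainder rows FILE 81 at both spacings; cut defect P-IIc; remainder defect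
FILE 80; partition FILES 66∕67∕72; smallness FILE 45).  With FILE 73 (iii) both members are the torus propagators `Δ_a⁻¹` at the two spacings.
[cite: Balaban1984PropagatorsII, (2.36)–(2.37) p.229, (2.91)–(2.93) p.239, (2.133)–(2.136) p.247 (mechanism), p.238 (T_□); Balaban1985BackgroundPropagators, Thm 3.1 p.397
(«M ≥ M₁»), Thm 3.14 pp.426–427 (difference template); Balaban1984PropagatorsI, (1.121)–(1.123) p.37, Prop. 1.2 (1.110) p.35, (1.126) p.38] -/
theorem hasMaj_idef_knitGluedR (hL : Odd L ∧ 1 < L) {a : ℝ} (ha : 0 < a) :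
    ∃ δ w₀ D : ℝ, 0 < δ ∧ 0 < D ∧ ∀ (s mT K r : ℕ) (hs : s + 1 ≤ mT) (_hK : 1 ≤ K) (_hn4 : 4 ≤ L ^ K), w₀ ≤ ((L ^ s : ℕ) : ℝ) →
      HasMaj (BlockNorm.ofBlocks (unitTorusGeo L K (MP (paramsOf d L mT K hL)))
          (fun b : Tor (fine (L ^ K) (MP (paramsOf d L mT K hL))) × Fin (d + 1) => blockOf (L ^ K) (MP (paramsOf d L mT K hL)) b.1))
        (BlockNorm.ofBlocks (unitTorusGeo L K (MP (paramsOf d L mT K hL)))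
          (fun i : Tor (fine (L ^ r * L ^ K) (MP (paramsOf d L mT K hL))) × Fin (d + 1) => blockOf (L ^ r * L ^ K) (MP (paramsOf d L mT K hL)) i.1))
        (idef (pull (kingPrV L K r (MP (paramsOf d L mT K hL)))) (pull (kingPrV L K r (MP (paramsOf d L mT K hL))))
          (knitGluedR d L s mT K (L ^ r * L ^ K) hL hs a) (knitGluedR d L s mT K (L ^ K) hL hs a))
        (fun y y' => D * ((L ^ K : ℕ) : ℝ) ^ (-(1 / 16 : ℝ)) * Real.exp (-(δ * tdistT (MP (paramsOf d L mT K hL)) y y'))) := by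
  have hL3 : 3 ≤ L := by obtain ⟨⟨j, hj⟩, h1⟩ := hL; omega
  have hLpos : 0 < L := by omega
  have hLodd : Odd L := hL.1
  have hL2 : 2 ≤ L := hL.2
  -- the letters, all free of the volume
  obtain ⟨δG, βG, hδG, hβG, HG⟩ := hasMaj_chiCube_liftCubeG (d := d) hL ha
  obtain ⟨δG', βG', hδG', hβG', HG'⟩ := hasMaj_chiCube_liftCubeG_fine (d := d) hL ha
  obtain ⟨δ2, κ2, hδ2, hκ2, HK⟩ := hasMaj_commOp_deltaOp_comp_knitGR_row (d := d) hL ha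
  obtain ⟨δ3, κ3, hδ3, hκ3, HK'⟩ := hasMaj_commOp_deltaOp_comp_knitGR_row_fine (d := d) hL ha
  obtain ⟨δc, mc, hδc, hmc, HIC⟩ := hasMaj_idef_chiCube_liftCubeG (d := d) hLodd hL2 ha (γ := 1 / 8) (by norm_num) (by norm_num)
  obtain ⟨δ7, Cr, hδ7, hCr, H7⟩ := hasMaj_idef_commOp_deltaOp_comp_knitGR_closed (d := d) hL ha
  -- the common rate and constants
  set δ : ℝ := min (min (min δG δG') (min δ2 δ3)) (min δc δ7) with hδ_def
  have hδ : 0 < δ := lt_min (lt_min (lt_min hδG hδG') (lt_min hδ2 hδ3)) (lt_min hδc hδ7)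
  have hdG : δ ≤ δG := (min_le_left _ _).trans ((min_le_left _ _).trans (min_le_left _ _))
  have hdG' : δ ≤ δG' := (min_le_left _ _).trans ((min_le_left _ _).trans (min_le_right _ _))
  have hd2 : δ ≤ δ2 := (min_le_left _ _).trans ((min_le_right _ _).trans (min_le_left _ _))
  have hd3 : δ ≤ δ3 := (min_le_left _ _).trans ((min_le_right _ _).trans (min_le_right _ _))
  have hdc : δ ≤ δc := (min_le_right _ _).trans (min_le_left _ _)
  have hd7 : δ ≤ δ7 := (min_le_right _ _).trans (min_le_right _ _)
  set cr : ℝ := B4Sect5Proof.latticeConst (d + 1) (δ / 4) with hcr_def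
  have hcr : 0 ≤ cr := B4Sect5Proof.latticeConst_nonneg (d + 1) (by positivity)
  set β : ℝ := max βG βG' with hβ_def
  have hβ : 0 ≤ β := hβG.le.trans (le_max_left _ _)
  set κ₀ : ℝ := max κ2 κ3 with hκ₀_def
  have hκ₀ : 0 ≤ κ₀ := hκ2.trans (le_max_left _ _)
  set Nov : ℝ := ((((L + 1) ^ (d + 1) : ℕ)) : ℝ) with hNov_def
  set D : ℝ := (Nov * β * (2 * (2 * (Nov * (κ₀ * (π * (d + 1)) + Cr)) * cr) * cr) * cr + Nov * (2 * β * (π * (d + 1)) + mc) * 2 * cr) + 1 with hD_def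
  refine ⟨δ - 2 * (δ / 4), 2 * (Nov * κ₀) * cr + 1, D, by linarith, by positivity, fun s mT K r hs hK1 hn4 hw₀ => ?_⟩
  -- the index's data
  set M : Fin (d + 1) → ℕ := MP (paramsOf d L mT K hL) with hMdef
  have hs' : s ≤ mT := by omega
  have hM : ∀ ν, M ν = 2 * L ^ (mT - s) * L ^ s := MP_eq_two_mul L s mT K hL hs'
  have hw : 0 < L ^ s := pow_pos hLpos s
  have hn : 1 ≤ L ^ K := Nat.one_le_pow _ _ hLpos
  haveI : NeZero (L ^ (mT - s)) := ⟨pow_ne_zero _ (NeZero.ne L)⟩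
  have hSe : L ^ (s + 1) = L * L ^ s := by rw [pow_succ, mul_comm]
  have hfit : 2 * coverMargin L s + 2 * L ^ s + 1 ≤ L ^ (s + 1) := by rw [hSe]; exact coverMargin_fit hL3 s
  have hfit1 : coverMargin L s + 2 * L ^ s + 1 ≤ L ^ (s + 1) := by omega
  have hS : L ^ (s + 1) ≤ 2 * L ^ (mT - s) * L ^ s := by
    rw [← hM 0]
    show L ^ (s + 1) ≤ 2 * L ^ mT
    have := Nat.pow_le_pow_right hLpos hs
    omega
  have hwR : (1 : ℝ) ≤ ((L ^ s : ℕ) : ℝ) := by exact_mod_cast hw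
  have hwpos : (0 : ℝ) < ((L ^ s : ℕ) : ℝ) := by linarith
  have hnR : (1 : ℝ) ≤ ((L ^ K : ℕ) : ℝ) := by exact_mod_cast hn
  set ε : ℝ := ((L ^ K : ℕ) : ℝ) ^ (-(1 / 16 : ℝ)) with hε_def
  obtain ⟨-, hnwε, -, hε0⟩ := rpow_sixteenth_facts hnR hwR
  have hexp16 : (-((1 : ℝ) / 8 / 2)) = -(1 / 16 : ℝ) := by norm_num
  have hrow := rowSum_unitTorusGeo (L := L) (k := K) (M := M) (σ := δ / 4) (by positivity)
  have hblk : (fun i : Tor (fine (L ^ r * L ^ K) M) × Fin (d + 1) => blockOf (L ^ r * L ^ K) M i.1) =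
      (fun b : Tor (fine (L ^ K) M) × Fin (d + 1) => blockOf (L ^ K) M b.1) ∘ kingPrV L K r M := (VectorPiece.blkFine_comp_kingPrV (M := M) L K r).symm
  have hind : ∀ (k : Fin (d + 1) → ZMod (2 * L ^ (mT - s))) (y y' : Tor M),
      0 ≤ ind (g := unitTorusGeo L K M) ((cubeBlocks M (coverCorner M (L ^ s) (L ^ (mT - s)) (coverMargin L s) k) (L ^ (s + 1)) : Finset (Tor M)) : Set (Tor M)) y *
        ind (g := unitTorusGeo L K M) ((cubeBlocks M (coverCorner M (L ^ s) (L ^ (mT - s)) (coverMargin L s) k) (L ^ (s + 1)) : Finset (Tor M)) : Set (Tor M)) y' :=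
    fun k y y' => mul_nonneg (ind_nonneg _ _) (ind_nonneg _ _)
  have hind1 : ∀ (k : Fin (d + 1) → ZMod (2 * L ^ (mT - s))) (y y' : Tor M),
      0 ≤ ind (g := unitTorusGeo L K M) ((cubeBlocks M (coverCorner M (L ^ s) (L ^ (mT - s)) (coverMargin L s) k) (L ^ (s + 1)) : Finset (Tor M)) : Set (Tor M)) y' :=
    fun k _ y' => ind_nonneg _ _
  have hκw : ∀ {κ : ℝ}, κ ≤ κ₀ → κ / ((L ^ s : ℕ) : ℝ) ≤ κ₀ / ((L ^ s : ℕ) : ℝ) := fun h => div_le_div_of_nonneg_right h hwpos.le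
  -- the cut rows at both spacings (P-IIb, P-IIe), rate `δ`, constant `β`
  have hGc : ∀ k : Fin (d + 1) → ZMod (2 * L ^ (mT - s)),
      HasMaj (BlockNorm.ofBlocks (unitTorusGeo L K M) (fun b : Tor (fine (L ^ K) M) × Fin (d + 1) => blockOf (L ^ K) M b.1))
        (BlockNorm.ofBlocks (unitTorusGeo L K M) (fun b : Tor (fine (L ^ K) M) × Fin (d + 1) => blockOf (L ^ K) M b.1))
        (mulOp (chiCube M (L ^ K) (coverCorner M (L ^ s) (L ^ (mT - s)) (coverMargin L s) k) (L ^ (s + 1))) ∘ₗ knitGR d L s mT K (L ^ K) hL hs a k)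
        (fun y y' => ind ((cubeBlocks M (coverCorner M (L ^ s) (L ^ (mT - s)) (coverMargin L s) k) (L ^ (s + 1)) : Finset (Tor M)) : Set (Tor M)) y *
          ind ((cubeBlocks M (coverCorner M (L ^ s) (L ^ (mT - s)) (coverMargin L s) k) (L ^ (s + 1)) : Finset (Tor M)) : Set (Tor M)) y' *
          (β * Real.exp (-(δ * tdistT M y y')))) := fun k =>
    (hasMaj_rate_le (hind k) hβG.le hdG (HG (s + 1) mT K hs hK1 _)).mono fun y y' =>
      mul_le_mul_of_nonneg_left (mul_le_mul_of_nonneg_right (le_max_left _ _) (Real.exp_nonneg _)) (hind k y y')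
  have hGc' : ∀ k : Fin (d + 1) → ZMod (2 * L ^ (mT - s)),
      HasMaj (BlockNorm.ofBlocks (unitTorusGeo L K M) ((fun b : Tor (fine (L ^ K) M) × Fin (d + 1) => blockOf (L ^ K) M b.1) ∘ kingPrV L K r M))
        (BlockNorm.ofBlocks (unitTorusGeo L K M) ((fun b : Tor (fine (L ^ K) M) × Fin (d + 1) => blockOf (L ^ K) M b.1) ∘ kingPrV L K r M))
        (mulOp (chiCube M (L ^ r * L ^ K) (coverCorner M (L ^ s) (L ^ (mT - s)) (coverMargin L s) k) (L ^ (s + 1))) ∘ₗ knitGR d L s mT K (L ^ r * L ^ K) hL hs a k)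
        (fun y y' => ind ((cubeBlocks M (coverCorner M (L ^ s) (L ^ (mT - s)) (coverMargin L s) k) (L ^ (s + 1)) : Finset (Tor M)) : Set (Tor M)) y *
          ind ((cubeBlocks M (coverCorner M (L ^ s) (L ^ (mT - s)) (coverMargin L s) k) (L ^ (s + 1)) : Finset (Tor M)) : Set (Tor M)) y' *
          (β * Real.exp (-(δ * tdistT M y y')))) := fun k => by
    rw [← hblk]
    exact (hasMaj_rate_le (hind k) hβG'.le hdG' (HG' (s + 1) mT K r hs hK1 _)).mono fun y y' =>
      mul_le_mul_of_nonneg_left (mul_le_mul_of_nonneg_right (le_max_right _ _) (Real.exp_nonneg _)) (hind k y y')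
  -- the remainder rows at both spacings (FILE 81), rate `δ`, `θ₀ = κ₀ ∕ L^s`
  have hK : ∀ k : Fin (d + 1) → ZMod (2 * L ^ (mT - s)),
      HasMaj (BlockNorm.ofBlocks (unitTorusGeo L K M) (fun b : Tor (fine (L ^ K) M) × Fin (d + 1) => blockOf (L ^ K) M b.1))
        (BlockNorm.ofBlocks (unitTorusGeo L K M) (fun b : Tor (fine (L ^ K) M) × Fin (d + 1) => blockOf (L ^ K) M b.1))
        (commOp (deltaOp M (L ^ K) a) (knitHR d L s mT K (L ^ K) hL k) ∘ₗ knitGR d L s mT K (L ^ K) hL hs a k)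
        (fun y y' => ind ((cubeBlocks M (coverCorner M (L ^ s) (L ^ (mT - s)) (coverMargin L s) k) (L ^ (s + 1)) : Finset (Tor M)) : Set (Tor M)) y' *
          (κ₀ / ((L ^ s : ℕ) : ℝ) * Real.exp (-(δ * tdistT M y y')))) := fun k =>
    (hasMaj_rate_le (hind1 k) (by positivity) hd2 (HK s mT K hs hK1 k)).mono fun y y' =>
      mul_le_mul_of_nonneg_left (mul_le_mul_of_nonneg_right (hκw (le_max_left _ _)) (Real.exp_nonneg _)) (ind_nonneg _ _)
  have hK' : ∀ k : Fin (d + 1) → ZMod (2 * L ^ (mT - s)),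
      HasMaj (BlockNorm.ofBlocks (unitTorusGeo L K M) ((fun b : Tor (fine (L ^ K) M) × Fin (d + 1) => blockOf (L ^ K) M b.1) ∘ kingPrV L K r M))
        (BlockNorm.ofBlocks (unitTorusGeo L K M) ((fun b : Tor (fine (L ^ K) M) × Fin (d + 1) => blockOf (L ^ K) M b.1) ∘ kingPrV L K r M))
        (commOp (deltaOp M (L ^ r * L ^ K) a) (knitHR d L s mT K (L ^ r * L ^ K) hL k) ∘ₗ knitGR d L s mT K (L ^ r * L ^ K) hL hs a k)
        (fun y y' => ind ((cubeBlocks M (coverCorner M (L ^ s) (L ^ (mT - s)) (coverMargin L s) k) (L ^ (s + 1)) : Finset (Tor M)) : Set (Tor M)) y' *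
          (κ₀ / ((L ^ s : ℕ) : ℝ) * Real.exp (-(δ * tdistT M y y')))) := fun k => by
    rw [← hblk]
    exact (hasMaj_rate_le (hind1 k) (by positivity) hd3 (HK' s mT K r hs hK1 k)).mono fun y y' =>
      mul_le_mul_of_nonneg_left (mul_le_mul_of_nonneg_right (hκw (le_max_right _ _)) (Real.exp_nonneg _)) (ind_nonneg _ _)
  -- the defects: cut (P-IIc) and remainder (FILE 80)
  have hDGc : ∀ k : Fin (d + 1) → ZMod (2 * L ^ (mT - s)),
      HasMaj (BlockNorm.ofBlocks (unitTorusGeo L K M) (fun b : Tor (fine (L ^ K) M) × Fin (d + 1) => blockOf (L ^ K) M b.1))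
        (BlockNorm.ofBlocks (unitTorusGeo L K M) ((fun b : Tor (fine (L ^ K) M) × Fin (d + 1) => blockOf (L ^ K) M b.1) ∘ kingPrV L K r M))
        (idef (pull (kingPrV L K r M)) (pull (kingPrV L K r M))
          (mulOp (chiCube M (L ^ r * L ^ K) (coverCorner M (L ^ s) (L ^ (mT - s)) (coverMargin L s) k) (L ^ (s + 1))) ∘ₗ knitGR d L s mT K (L ^ r * L ^ K) hL hs a k)
          (mulOp (chiCube M (L ^ K) (coverCorner M (L ^ s) (L ^ (mT - s)) (coverMargin L s) k) (L ^ (s + 1))) ∘ₗ knitGR d L s mT K (L ^ K) hL hs a k))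
        (fun y y' => ind ((cubeBlocks M (coverCorner M (L ^ s) (L ^ (mT - s)) (coverMargin L s) k) (L ^ (s + 1)) : Finset (Tor M)) : Set (Tor M)) y *
          ind ((cubeBlocks M (coverCorner M (L ^ s) (L ^ (mT - s)) (coverMargin L s) k) (L ^ (s + 1)) : Finset (Tor M)) : Set (Tor M)) y' * (mc * ε * Real.exp (-(δ * tdistT M y y')))) :=
    fun k => by
    have h := HIC (s + 1) mT K r hK1 hL hs (coverCorner M (L ^ s) (L ^ (mT - s)) (coverMargin L s) k)
    rw [hexp16] at h
    have h2 := hasMaj_rate_le (hind k) (by positivity : 0 ≤ mc * ε) hdc h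
    rw [hblk] at h2
    exact h2
  have hDK : ∀ k : Fin (d + 1) → ZMod (2 * L ^ (mT - s)),
      HasMaj (BlockNorm.ofBlocks (unitTorusGeo L K M) (fun b : Tor (fine (L ^ K) M) × Fin (d + 1) => blockOf (L ^ K) M b.1))
        (BlockNorm.ofBlocks (unitTorusGeo L K M) ((fun b : Tor (fine (L ^ K) M) × Fin (d + 1) => blockOf (L ^ K) M b.1) ∘ kingPrV L K r M))
        (idef (pull (kingPrV L K r M)) (pull (kingPrV L K r M))
          (commOp (deltaOp M (L ^ r * L ^ K) a) (knitHR d L s mT K (L ^ r * L ^ K) hL k) ∘ₗ knitGR d L s mT K (L ^ r * L ^ K) hL hs a k)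
          (commOp (deltaOp M (L ^ K) a) (knitHR d L s mT K (L ^ K) hL k) ∘ₗ knitGR d L s mT K (L ^ K) hL hs a k))
        (fun y y' => ind ((cubeBlocks M (coverCorner M (L ^ s) (L ^ (mT - s)) (coverMargin L s) k) (L ^ (s + 1)) : Finset (Tor M)) : Set (Tor M)) y' *
          (Cr * ε * Real.exp (-(δ * tdistT M y y')))) := fun k => by
    have h := hasMaj_rate_le (hind1 k) (by positivity : 0 ≤ Cr * ε) hd7 (H7 s mT K r hs hK1 hn4 k)
    rw [hblk] at h
    exact h
  -- the partition: cuts, bounds, fit, overlap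
  have hcut : ∀ k : Fin (d + 1) → ZMod (2 * L ^ (mT - s)), mulOp (knitHR d L s mT K (L ^ K) hL k) ∘ₗ
      mulOp (chiCube M (L ^ K) (coverCorner M (L ^ s) (L ^ (mT - s)) (coverMargin L s) k) (L ^ (s + 1))) = mulOp (knitHR d L s mT K (L ^ K) hL k) := fun k =>
    hcube_cut (2 * L ^ (mT - s)) (coverXi M (L ^ K) (L ^ s)) (bshiftEquiv M (L ^ K)) 0
      (chiCube_coverCorner_eq_one_side (M := M) (n := L ^ K) (m₀ := coverMargin L s) hM hw hfit1 hS 0 k)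
  have hcut' : ∀ k : Fin (d + 1) → ZMod (2 * L ^ (mT - s)), mulOp (knitHR d L s mT K (L ^ r * L ^ K) hL k) ∘ₗ
      mulOp (chiCube M (L ^ r * L ^ K) (coverCorner M (L ^ s) (L ^ (mT - s)) (coverMargin L s) k) (L ^ (s + 1))) = mulOp (knitHR d L s mT K (L ^ r * L ^ K) hL k) := fun k =>
    hcube_cut (2 * L ^ (mT - s)) (coverXi M (L ^ r * L ^ K) (L ^ s)) (bshiftEquiv M (L ^ r * L ^ K)) 0
      (chiCube_coverCorner_eq_one_side (M := M) (n := L ^ r * L ^ K) (m₀ := coverMargin L s) hM hw hfit1 hS 0 k)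
  have hh : ∀ (k : Fin (d + 1) → ZMod (2 * L ^ (mT - s))) x, |knitHR d L s mT K (L ^ K) hL k x| ≤ 1 := fun k x => abs_coverH_le_one k x
  have hh' : ∀ (k : Fin (d + 1) → ZMod (2 * L ^ (mT - s))) x', |knitHR d L s mT K (L ^ r * L ^ K) hL k x'| ≤ 1 := fun k x' => abs_coverH_le_one k x'
  have hfitH : ∀ (k : Fin (d + 1) → ZMod (2 * L ^ (mT - s))) x', |knitHR d L s mT K (L ^ r * L ^ K) hL k x' - knitHR d L s mT K (L ^ K) hL k (kingPrV L K r M x')| ≤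
      π * (d + 1) / (((L ^ K : ℕ) : ℝ) * ((L ^ s : ℕ) : ℝ)) := fun k x' => abs_coverH_fine_sub_le (L := L) (kk := K) (r := r) hM hw k x'
  have hNovEq : L ^ (s + 1) / L ^ s + 1 = L + 1 := by rw [pow_succ, Nat.mul_div_cancel_left L hw]
  have hN : ∀ y : Tor M, ∑ k : Fin (d + 1) → ZMod (2 * L ^ (mT - s)),
      ind (g := unitTorusGeo L K M) ((cubeBlocks M (coverCorner M (L ^ s) (L ^ (mT - s)) (coverMargin L s) k) (L ^ (s + 1)) : Finset (Tor M)) : Set (Tor M)) y ≤ Nov := fun y => by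
    have := sum_ind_cubeBlocks_le_overlap (M := M) (w := L ^ s) (q := L ^ (mT - s)) (m₀ := coverMargin L s) (S := L ^ (s + 1)) hM hw L K y
    rwa [hNovEq] at this
  -- the smallness
  have hMge : 2 * (Nov * κ₀) * cr ≤ ((L ^ s : ℕ) : ℝ) := by linarith
  obtain ⟨hq, hinv⟩ := glued_smallness_of_M (cr := cr) (κ₀ := κ₀) (Nov := Nov) hwpos hMge
  -- FILE 63
  have key := hasMaj_idef_glued_of_cutRows (g := unitTorusGeo L K M) (fun b : Tor (fine (L ^ K) M) × Fin (d + 1) => blockOf (L ^ K) M b.1) (kingPrV L K r M)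
    (fun k => ((cubeBlocks M (coverCorner M (L ^ s) (L ^ (mT - s)) (coverMargin L s) k) (L ^ (s + 1)) : Finset (Tor M)) : Set (Tor M)))
    (triangle254_unitTorusGeo L K M) (unitTorusGeo_dist_nonneg L K M) (unitTorusGeo_dist_self L K M) hrow (by positivity) hcr
    (Δ := deltaOp M (L ^ K) a) (Δ' := deltaOp M (L ^ r * L ^ K) a) (h := knitHR d L s mT K (L ^ K) hL) (h' := knitHR d L s mT K (L ^ r * L ^ K) hL)
    (G := knitGR d L s mT K (L ^ K) hL hs a) (G' := knitGR d L s mT K (L ^ r * L ^ K) hL hs a)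
    hβ (by positivity : 0 ≤ κ₀ / ((L ^ s : ℕ) : ℝ)) (by positivity : 0 ≤ mc * ε) (by positivity : 0 ≤ Cr * ε)
    (by positivity : (0 : ℝ) ≤ π * (d + 1) / (((L ^ K : ℕ) : ℝ) * ((L ^ s : ℕ) : ℝ))) (by positivity) (by linarith : 2 * (δ / 4) ≤ δ)
    hcut hcut' hh hh' hfitH hN hGc hGc' hK hK' hDGc hDK hq
  rw [← hblk] at key
  refine key.mono fun y y' => mul_le_mul_of_nonneg_right ?_ (Real.exp_nonneg _)
  -- the compression
  clear key hDK hDGc hK' hK hGc' hGc hcut hcut' hh hh' hfitH hN H7 HIC HK HK' HG HG' hrow hblk hind hind1 hκw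
  have hθκ : κ₀ / ((L ^ s : ℕ) : ℝ) ≤ κ₀ := div_le_self hκ₀ hwR
  have ho : π * (d + 1) / (((L ^ K : ℕ) : ℝ) * ((L ^ s : ℕ) : ℝ)) ≤ π * (d + 1) * ε := by
    rw [div_eq_mul_inv]; exact mul_le_mul_of_nonneg_left hnwε (by positivity)
  have hinv0 : 0 ≤ (1 - Nov * (κ₀ / ((L ^ s : ℕ) : ℝ)) * cr)⁻¹ := inv_nonneg.mpr (sub_nonneg.mpr hq.le)
  have hcomp := glueDefectConst_le (Ko := π * (d + 1)) (mc := mc) (Cr := Cr) (m := mc * ε) (r := Cr * ε) (by positivity : 0 ≤ Nov) hβ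
    (by positivity : 0 ≤ κ₀ / ((L ^ s : ℕ) : ℝ)) hθκ hcr hε0 (by positivity) hmc.le (by positivity) ho (by positivity) (le_refl (mc * ε)) (le_refl (Cr * ε)) hinv0 hinv
  refine hcomp.trans ?_
  rw [hD_def, add_mul _ (1 : ℝ) ε, one_mul]
  exact le_add_of_nonneg_right hε0

end Glued

end Summit.QuantumFields.YangMills.BalabanUVNodes.N15.Gluing

end
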